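import Summits.ValiantsHypothesis.ValiantsHypothesis.Theorems.LacunarySymmetroidMatrixDescartesVSQGenRec
import Summits.ValiantsHypothesis.ValiantsHypothesis.Theorems.LacunarySymmetroidMatrixDescartesVSQGenDesign
import Summits.ValiantsHypothesis.ValiantsHypothesis.Theorems.LacunarySymmetroidMatrixDescartesVSQTriPoints1

/-!
# `MatrixDescartes` census — the recursive tridiagonal family: INDUCTION INVARIANT and the flat-regime step

HONEST FRAMING.  Val-V1-extremal engine seat val-v1x-eng-6 (g2), `--supports stmt-ValiantsHypothesis-18050` (helper).  The quantitative
invariant of the all-`(m,K)` law (`…VSQGenInv`): `INVf n B L` — on the flat regime `0 < u ≤ B^{−1}` the `L`-level determinant `fL L`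
has the sign `sflat L` and size within `[2^{−L}, 2^{L}] · B^{L·qa}`; `INVp n B L` — at its `j`-th test point it has the sign `ss L j`
and size within `[2^{−L}, 2^{L}] · Vv L j`.  Pure-real step rules `stepU_real` / `stepW_real` (main term = certified factor × inner
determinant, plus an error at most a quarter of the lower bound), and the flat-regime step `step_flat :
INVf L → INVf (L+1) → INVf (L+2)` (`B ≥ 8K²4^L`, `B ≥ 16K²`).  Nothing here bears on the crux `MatrixDescartes` (stmt-18050) or on
`VP ≠ VNP`.
[folklore] Elementary.
-/

set_option linter.dupNamespace false
set_option autoImplicit false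

namespace Summit.ValiantsHypothesis.ValiantsHypothesis.Theorems.LacunarySymmetroidMatrixDescartes.VSQ

open scoped BigOperators
open Finset

/-- flat-regime invariant of the `L`-level system. [folklore] -/
def INVf (n : ℕ) (B : ℝ) (L : ℕ) : Prop :=
  ∀ u : ℝ, 0 < u → u ≤ B ^ (-1 : ℤ) →
    (1 / 2 : ℝ) ^ L * B ^ ((L : ℤ) * qa n) ≤ sflat n L * fL n B L u ∧
      sflat n L * fL n B L u ≤ (2 : ℝ) ^ L * B ^ ((L : ℤ) * qa n)

/-- test-point invariant of the `L`-level system. [folklore] -/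
def INVp (n : ℕ) (B : ℝ) (L : ℕ) : Prop :=
  ∀ j : ℕ, j < npts n L →
    (1 / 2 : ℝ) ^ L * Vv n B L j ≤ ss n L j * fL n B L (tp n B L j) ∧
      ss n L j * fL n B L (tp n B L j) ≤ (2 : ℝ) ^ L * Vv n B L j

variable {n : ℕ} {B : ℝ}

/-! ## 1. Pure-real step rules -/

/-- **U-step**: certified factor × inner determinant + small error. [folklore] -/
theorem stepU_real {P F E Va W sa sf lo hi : ℝ} (hVa : 0 < Va) (hW : 0 < W) (hlo : 0 < lo)
    (hsa : |sa| = 1) (hP : |P - sa * Va| ≤ Va / 8) (hF : lo * W ≤ sf * F ∧ sf * F ≤ hi * W)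
    (hE : |E| ≤ lo * (Va * W) / 4) :
    lo / 2 * (Va * W) ≤ sa * sf * (P * F) + E ∧ sa * sf * (P * F) + E ≤ 2 * hi * (Va * W) := by
  obtain ⟨a1, a2, -⟩ := cert_bounds hsa hP
  obtain ⟨f1, f2⟩ := hF
  obtain ⟨e1, e2⟩ := abs_le.1 hE
  have hsfF : 0 ≤ sf * F := le_trans (by positivity) f1
  have m1 : (7 * Va / 8) * (lo * W) ≤ (sa * P) * (sf * F) := mul_le_mul a1 f1 (by positivity) (le_trans (by positivity) a1)
  have m2 : (sa * P) * (sf * F) ≤ (9 * Va / 8) * (hi * W) := mul_le_mul a2 f2 hsfF (by positivity)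
  have e : sa * sf * (P * F) = (sa * P) * (sf * F) := by ring
  rw [e]
  constructor <;> nlinarith [mul_pos hVa hW, mul_pos hlo (mul_pos hVa hW)]

/-- **W-step**: certified link squared × inner determinant + small error. [folklore] -/
theorem stepW_real {Q F E V W s sf lo hi : ℝ} (hV : 0 < V) (hW : 0 < W) (hlo : 0 < lo)
    (hs : |s| = 1) (hQ : |Q - s * V| ≤ V / 8) (hF : lo * W ≤ sf * F ∧ sf * F ≤ hi * W)
    (hE : |E| ≤ lo * (V ^ 2 * W) / 4) :
    lo / 4 * (V ^ 2 * W) ≤ Q ^ 2 * (sf * F) + E ∧ Q ^ 2 * (sf * F) + E ≤ 2 * hi * (V ^ 2 * W) := by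
  obtain ⟨a1, a2, a3⟩ := cert_bounds hs hQ
  obtain ⟨f1, f2⟩ := hF
  obtain ⟨e1, e2⟩ := abs_le.1 hE
  have hsfF : 0 ≤ sf * F := le_trans (by positivity) f1
  have hQabs : 7 * V / 8 ≤ |Q| := by
    calc 7 * V / 8 ≤ s * Q := a1
      _ ≤ |s * Q| := le_abs_self _
      _ = |Q| := by rw [abs_mul, hs, one_mul]
  have q1 : (7 * V / 8) ^ 2 ≤ Q ^ 2 := by rw [← sq_abs Q]; exact pow_le_pow_left₀ (by positivity) hQabs 2
  have q2 : Q ^ 2 ≤ (9 * V / 8) ^ 2 := by rw [← sq_abs Q]; exact pow_le_pow_left₀ (abs_nonneg _) a3 2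
  have m1 : (7 * V / 8) ^ 2 * (lo * W) ≤ Q ^ 2 * (sf * F) := mul_le_mul q1 f1 (by positivity) (sq_nonneg _)
  have m2 : Q ^ 2 * (sf * F) ≤ (9 * V / 8) ^ 2 * (hi * W) := mul_le_mul q2 f2 hsfF (by positivity)
  constructor <;> nlinarith [mul_pos (pow_pos hV 2) hW, mul_pos hlo (mul_pos (pow_pos hV 2) hW)]

/-! ## 2. Small helpers -/

/-- `|sflat| = 1`. [folklore] -/
theorem abs_sflat (n : ℕ) : ∀ L : ℕ, |sflat n L| = 1
  | 0 => by simp [sflat]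
  | 1 => by simp [sflat]
  | L + 2 => by rw [sflat, abs_mul, abs_mul, abs_sflat n (L + 1)]; simp

/-- the flat sign recursion. [folklore] -/
theorem sflat_succ_succ (n L : ℕ) : sflat n (L + 2) = (-1) ^ n * ((-1) ^ n) ^ (L + 1) * sflat n (L + 1) := rfl

/-- powers of the level sign square to one. [folklore] -/
theorem gpow_sq (n k : ℕ) : (((-1 : ℝ) ^ n) ^ k) ^ 2 = 1 := by
  rw [← pow_mul, ← pow_mul, show n * (k * 2) = 2 * (n * k) by ring, pow_mul]; norm_num

/-- from two-sided signed bounds to an absolute bound. [folklore] -/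
theorem abs_le_of_signed {s f lo hi W : ℝ} (hs : |s| = 1) (hlo : 0 ≤ lo * W) (h : lo * W ≤ s * f ∧ s * f ≤ hi * W) :
    |f| ≤ hi * W := by
  have : |f| = |s * f| := by rw [abs_mul, hs, one_mul]
  rw [this, abs_of_nonneg (le_trans hlo h.1)]
  exact h.2

/-- a constant `C ≤ B` is absorbed by one unit of the base. [folklore] -/
theorem zgap (hB1 : 1 < B) {C : ℝ} (hC : C ≤ B) {P Q : ℤ} (H : P + 1 ≤ Q) : C * B ^ P ≤ B ^ Q := by
  have hB0 : 0 < B := lt_trans zero_lt_one hB1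
  calc C * B ^ P ≤ B * B ^ P := mul_le_mul_of_nonneg_right hC (zpow_pos hB0 _).le
    _ = B ^ (P + 1) := by rw [mul_comm, zpow_add_one₀ hB0.ne']
    _ ≤ B ^ Q := zpow_le_zpow_right₀ hB1.le H

/-- `B^{−σ} u ≤ u` for `u ≥ 0`, `B ≥ 1`. [folklore] -/
theorem shift_le (hB1 : 1 < B) {u : ℝ} (hu : 0 ≤ u) : B ^ (-(sg n : ℤ)) * u ≤ u := by
  have : B ^ (-(sg n : ℤ)) ≤ 1 := zpow_le_one_of_nonpos₀ hB1.le (by simp)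
  nlinarith

/-- flat size algebra: `B^{qa} · B^{(L+1) qa} = B^{(L+2) qa}`. [folklore] -/
theorem Cflat_succ (hB0 : B ≠ 0) (L : ℕ) :
    B ^ (qa n) * B ^ (((L + 1 : ℕ) : ℤ) * qa n) = B ^ (((L + 2 : ℕ) : ℤ) * qa n) := by
  rw [← zpow_add₀ hB0]; congr 1; push_cast; ring

/-- scalar identity `2^L · (2^{L+1} · 4) = 8 · 4^L`. [folklore] -/
theorem two_pow_ident (L : ℕ) : (2 : ℝ) ^ L * (2 ^ (L + 1) * 4) = 8 * 4 ^ L := by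
  rw [pow_succ, show (4 : ℝ) ^ L = 2 ^ L * 2 ^ L by rw [← mul_pow]; norm_num]; ring

/-- **U-error bound**: `(K B^{E−δ})² · 2^L B^{L qa} ≤ 2^{−(L+1)} B^A B^{(L+1) qa} / 4` from the gap `2(E − δ) + 1 ≤ A + qa`
(`B ≥ 8K²4^L`). [folklore] -/
theorem errU_bound (hB1 : 1 < B) {L : ℕ} (hBL : 8 * ((n + 2 : ℕ) : ℝ) ^ 2 * 4 ^ L ≤ B) {E A : ℤ}
    (H : 2 * (E - dlt n) + 1 ≤ A + qa n) :
    (((n + 2 : ℕ) : ℝ) * B ^ (E - dlt n)) ^ 2 * ((2 : ℝ) ^ L * B ^ ((L : ℤ) * qa n)) ≤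
      (1 / 2 : ℝ) ^ (L + 1) * (B ^ A * B ^ (((L + 1 : ℕ) : ℤ) * qa n)) / 4 := by
  have hB0 : 0 < B := lt_trans zero_lt_one hB1
  have key : (8 * ((n + 2 : ℕ) : ℝ) ^ 2 * 4 ^ L) * B ^ (2 * (E - dlt n) + (L : ℤ) * qa n) ≤
      B ^ (A + ((L + 1 : ℕ) : ℤ) * qa n) := zgap hB1 hBL (by push_cast; linarith)
  rw [← zpow_add₀ hB0.ne', one_div_pow]
  rw [show (((n + 2 : ℕ) : ℝ) * B ^ (E - dlt n)) ^ 2 * ((2 : ℝ) ^ L * B ^ ((L : ℤ) * qa n)) =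
      (((n + 2 : ℕ) : ℝ) ^ 2 * 2 ^ L) * B ^ (2 * (E - dlt n) + (L : ℤ) * qa n) by
    rw [zpow_add₀ hB0.ne', show (2 : ℤ) * (E - dlt n) = (E - dlt n) + (E - dlt n) by ring, zpow_add₀ hB0.ne']; ring]
  rw [show (1 : ℝ) / 2 ^ (L + 1) * B ^ (A + ((L + 1 : ℕ) : ℤ) * qa n) / 4 =
      B ^ (A + ((L + 1 : ℕ) : ℤ) * qa n) / (2 ^ (L + 1) * 4) by field_simp]
  rw [le_div_iff₀ (by positivity)]
  calc (((n + 2 : ℕ) : ℝ) ^ 2 * 2 ^ L) * B ^ (2 * (E - dlt n) + (L : ℤ) * qa n) * (2 ^ (L + 1) * 4)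
      = (8 * ((n + 2 : ℕ) : ℝ) ^ 2 * 4 ^ L) * B ^ (2 * (E - dlt n) + (L : ℤ) * qa n) := by
        linear_combination (((n + 2 : ℕ) : ℝ) ^ 2 * B ^ (2 * (E - dlt n) + (L : ℤ) * qa n)) * two_pow_ident L
    _ ≤ _ := key

/-- **W-error bound**: `(K B^A) · 2^{L+1} B^{(L+1) qa} ≤ 2^{−L} (B^{E−δ})² B^{L qa} / 4` from the gap `A + qa + 1 ≤ 2(E − δ)`
(`B ≥ 8K²4^L`). [folklore] -/
theorem errW_bound (hB1 : 1 < B) {L : ℕ} (hBL : 8 * ((n + 2 : ℕ) : ℝ) ^ 2 * 4 ^ L ≤ B) {E A : ℤ}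
    (H : A + qa n + 1 ≤ 2 * (E - dlt n)) :
    (((n + 2 : ℕ) : ℝ) * B ^ A) * ((2 : ℝ) ^ (L + 1) * B ^ (((L + 1 : ℕ) : ℤ) * qa n)) ≤
      (1 / 2 : ℝ) ^ L * ((B ^ (E - dlt n)) ^ 2 * B ^ ((L : ℤ) * qa n)) / 4 := by
  have hB0 : 0 < B := lt_trans zero_lt_one hB1
  have hK1 : (1 : ℝ) ≤ ((n + 2 : ℕ) : ℝ) := by exact_mod_cast (show 1 ≤ n + 2 by omega)
  have hBL' : 8 * ((n + 2 : ℕ) : ℝ) * 4 ^ L ≤ B := by nlinarith [pow_pos (show (0:ℝ) < 4 by norm_num) L]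
  have key : (8 * ((n + 2 : ℕ) : ℝ) * 4 ^ L) * B ^ (A + ((L + 1 : ℕ) : ℤ) * qa n) ≤
      B ^ (2 * (E - dlt n) + (L : ℤ) * qa n) := zgap hB1 hBL' (by push_cast; linarith)
  rw [show (B ^ (E - dlt n)) ^ 2 * B ^ ((L : ℤ) * qa n) = B ^ (2 * (E - dlt n) + (L : ℤ) * qa n) by
    rw [zpow_add₀ hB0.ne', show (2 : ℤ) * (E - dlt n) = (E - dlt n) + (E - dlt n) by ring, zpow_add₀ hB0.ne', sq]]
  rw [show (((n + 2 : ℕ) : ℝ) * B ^ A) * ((2 : ℝ) ^ (L + 1) * B ^ (((L + 1 : ℕ) : ℤ) * qa n)) =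
      (((n + 2 : ℕ) : ℝ) * 2 ^ (L + 1)) * B ^ (A + ((L + 1 : ℕ) : ℤ) * qa n) by rw [zpow_add₀ hB0.ne']; ring]
  rw [one_div_pow, show (1 : ℝ) / 2 ^ L * B ^ (2 * (E - dlt n) + (L : ℤ) * qa n) / 4 =
      B ^ (2 * (E - dlt n) + (L : ℤ) * qa n) / (2 ^ L * 4) by field_simp]
  rw [le_div_iff₀ (by positivity)]
  calc (((n + 2 : ℕ) : ℝ) * 2 ^ (L + 1)) * B ^ (A + ((L + 1 : ℕ) : ℤ) * qa n) * (2 ^ L * 4)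
      = (8 * ((n + 2 : ℕ) : ℝ) * 4 ^ L) * B ^ (A + ((L + 1 : ℕ) : ℤ) * qa n) := by
        linear_combination (((n + 2 : ℕ) : ℝ) * B ^ (A + ((L + 1 : ℕ) : ℤ) * qa n)) * two_pow_ident L
    _ ≤ _ := key

/-! ## 3. The flat-regime step -/

/-- **flat step**: `INVf L → INVf (L+1) → INVf (L+2)` (`B ≥ 16K²`, `B ≥ 8K²4^L`). [folklore] -/
theorem step_flat (hn : 2 ≤ n) (hB : 16 * ((n + 2 : ℕ) : ℝ) ^ 2 ≤ B) {L : ℕ} (hBL : 8 * ((n + 2 : ℕ) : ℝ) ^ 2 * 4 ^ L ≤ B)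
    (I0 : INVf n B L) (I1 : INVf n B (L + 1)) : INVf n B (L + 2) := by
  obtain ⟨hB1, h8, -⟩ := hB16 hB
  have hB0 : 0 < B := lt_trans zero_lt_one hB1
  intro u hu0 hu1
  set u' : ℝ := B ^ (-(sg n : ℤ)) * u with hu'
  set u'' : ℝ := B ^ (-(sg n : ℤ)) * u' with hu''
  have hu'0 : 0 < u' := mul_pos (zpow_pos hB0 _) hu0
  have hu''0 : 0 < u'' := mul_pos (zpow_pos hB0 _) hu'0
  have hu'1 : u' ≤ B ^ (-1 : ℤ) := (shift_le hB1 hu0.le).trans hu1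
  have hu''1 : u'' ≤ B ^ (-1 : ℤ) := (shift_le hB1 hu'0.le).trans hu'1
  rw [fL_rec hB0.ne' L u]
  -- certified factor `a(u) ≈ s^a_0 B^{qa}`
  obtain ⟨eVa, -⟩ := tv_consts (n := n) B u
  have cP := cert_of_dom h8 hB0 (fun l => abs_saR_le n l) (haF n) (dF n) hu0 0 (domA_low hn hB hu0 hu1 le_rfl)
  rw [eVa] at cP
  -- inner determinant, flat
  have hF := I1 u' hu'0 hu'1
  -- error
  have hb : |fb n B u| ≤ ((n + 2 : ℕ) : ℝ) * B ^ (eb n 1 (-1)) :=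
    abs_bnom_le hB0 (fun l => abs_sbR_le n l) (hbF n) (dF n) hu0 (zpow_pos hB0 _).le (belowB_low hB (y := -1) (by linarith) hu0.le hu1)
  have hf0 : |fL n B L u''| ≤ (2 : ℝ) ^ L * B ^ ((L : ℤ) * qa n) :=
    abs_le_of_signed (abs_sflat n L) (by positivity) (I0 u'' hu''0 hu''1)
  have hE : |-(sflat n (L + 2)) * ((B ^ (-(dlt n : ℤ)) * fb n B u) ^ 2 * fL n B L u'')| ≤
      (1 / 2 : ℝ) ^ (L + 1) * (B ^ qa n * B ^ (((L + 1 : ℕ) : ℤ) * qa n)) / 4 := by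
    rw [abs_mul, abs_neg, abs_sflat, one_mul, abs_mul, abs_pow, abs_mul, abs_of_pos (zpow_pos hB0 _)]
    have h1 : (B ^ (-(dlt n : ℤ)) * |fb n B u|) ^ 2 * |fL n B L u''| ≤
        (B ^ (-(dlt n : ℤ)) * (((n + 2 : ℕ) : ℝ) * B ^ (eb n 1 (-1)))) ^ 2 * ((2 : ℝ) ^ L * B ^ ((L : ℤ) * qa n)) :=
      mul_le_mul (pow_le_pow_left₀ (by positivity) (mul_le_mul_of_nonneg_left hb (zpow_pos hB0 _).le) 2) hf0
        (abs_nonneg _) (by positivity)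
    refine h1.trans ?_
    rw [q0_reshape hB0]
    have hg : 2 * (eb n 1 (-1) - dlt n) + 1 ≤ ea n 0 (-1) + qa n := gap0_low hn
    rw [ea_zero] at hg
    exact errU_bound hB1 hBL hg
  -- assemble
  have hsa : |saF n 0| = 1 := abs_saR_eq n 0
  have h := stepU_real (zpow_pos hB0 (qa n)) (by positivity) (by positivity) hsa cP hF hE
  have v0 : saF n 0 = (-1) ^ n := by show saR n 0 = _; rw [saR_zero]
  have hg2 := gpow_sq n (L + 1)
  have key : sflat n (L + 2) * (fa n B u * (((-1 : ℝ) ^ n) ^ (L + 1) * fL n B (L + 1) u') -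
      (B ^ (-(dlt n : ℤ)) * fb n B u) ^ 2 * fL n B L u'') =
      saF n 0 * sflat n (L + 1) * (fa n B u * fL n B (L + 1) u') +
        -(sflat n (L + 2)) * ((B ^ (-(dlt n : ℤ)) * fb n B u) ^ 2 * fL n B L u'') := by
    rw [sflat_succ_succ, v0]
    linear_combination ((-1 : ℝ) ^ n * sflat n (L + 1) * (fa n B u * fL n B (L + 1) u')) * hg2
  rw [key, ← Cflat_succ hB0.ne' L]
  constructor
  · calc (1 / 2 : ℝ) ^ (L + 2) * (B ^ qa n * B ^ (((L + 1 : ℕ) : ℤ) * qa n))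
        = (1 / 2 : ℝ) ^ (L + 1) / 2 * (B ^ qa n * B ^ (((L + 1 : ℕ) : ℤ) * qa n)) := by rw [pow_succ]; ring
      _ ≤ _ := h.1
  · calc _ ≤ 2 * (2 : ℝ) ^ (L + 1) * (B ^ qa n * B ^ (((L + 1 : ℕ) : ℤ) * qa n)) := h.2
      _ = (2 : ℝ) ^ (L + 2) * (B ^ qa n * B ^ (((L + 1 : ℕ) : ℤ) * qa n)) := by rw [pow_succ]; ring

end Summit.ValiantsHypothesis.ValiantsHypothesis.Theorems.LacunarySymmetroidMatrixDescartes.VSQ
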